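import Summits.HodgeConjecture.HodgeConjecture.Theses.GmtVisibleFractionBootstrap
import Summits.HodgeConjecture.HodgeConjecture.Theorems.HolomorphicityRatePolarisedLefschetzData
import HarnessLib

/-!
# Route `GmtVisibleFractionBootstrap`, item `PolarisedLefschetzData` (stmt-HodgeConjecture-18026, shared)

The support item `PolarisedLefschetzData` is shared VERBATIM between the routes `HolomorphicityRate`
and `GmtVisibleFractionBootstrap` (one work item, stmt-HodgeConjecture-18026, two route decls with
identical bodies). It was proved for the former as
`Summit.HodgeConjecture.HodgeConjecture.Theorems.polarisedLefschetzData_proof` from the unfolded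
statement `Summit.HodgeConjecture.HodgeConjecture.Theorems.polarisedLefschetzData`
(file `Theorems/HolomorphicityRatePolarisedLefschetzData`); this file records the same proof against
the LITERAL decl of the second route, so that its deciding theorem `closes … (pl : PolarisedLefschetzData)`
can be fed by name.

## References

* [VoisinHodgeI2002] C. Voisin, Hodge Theory and Complex Algebraic Geometry I (CUP 2002), Thm. 6.25,
  Rem. 6.27, §7.1.2, Thm. 7.10.
* [VoisinHodgeII2003] C. Voisin, Hodge Theory and Complex Algebraic Geometry II (CUP 2003), §9.2.4
  Prop. 9.20.
-/

noncomputable section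

-- `Summit.HodgeConjecture.HodgeConjecture.Theorems` is the mandated namespace (single-problem summit:
-- Problem = Summit), which `linter.dupNamespace` flags on every declaration; the lakefile turns the
-- linter off tree-wide (weak option), restated here so stand-alone elaboration is warning-free too.
set_option linter.dupNamespace false

namespace Summit.HodgeConjecture.HodgeConjecture.Theorems

/-- **`GmtVisibleFractionBootstrap.PolarisedLefschetzData` holds** (the shared item
stmt-HodgeConjecture-18026 read against the decl of route `GmtVisibleFractionBootstrap`): every
smooth projective complex `n`-fold carries a hard-Lefschetz datum whose class is Kähler and all of
whose cup powers are algebraic. [cite: VoisinHodgeI2002, Thm. 6.25, Rem. 6.27, §7.1.2 and Thm. 7.10]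
[cite: VoisinHodgeII2003, §9.2.4 Prop. 9.20] -/
theorem gmtVisibleFractionBootstrap_polarisedLefschetzData_proof :
    Summit.HodgeConjecture.HodgeConjecture.Theses.GmtVisibleFractionBootstrap.PolarisedLefschetzData := by
  unfold Summit.HodgeConjecture.HodgeConjecture.Theses.GmtVisibleFractionBootstrap.PolarisedLefschetzData
  exact polarisedLefschetzData

end Summit.HodgeConjecture.HodgeConjecture.Theorems

end
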